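import Mathlib
import Summits.CriticalPhenomena.CardyFormulaZ2.Theorems.CardySelfRefinementDefs
import Summits.CriticalPhenomena.CardyFormulaZ2.Theorems.CardySelfRefinementTrivialSectorRateStubPivotalMassDictionary
import Summits.CriticalPhenomena.CardyFormulaZ2.Theorems.CardySelfRefinementTrivialSectorRateStubPivotalMassWeights
import Literature.Probability.Percolation.PivotalCell
import Literature.Probability.Percolation.FourArmGarbanShift
import HarnessLib

/-!
# Dyadic-layer summation for stub `stub_pivotalMass` (line `far-field-is-a-quarter-turn`, crux
`TrivialSectorRate`, stmt-CriticalPhenomena-10266): the weighted pivotal mass from three inputs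

`weightedPivotalMass_of_factorisation` (registered helper): for a fixed `k > 0`, path `γ` and quad
family `F`, the conclusion of `stub_pivotalMass` — for every contact radius `r > 0`,
`Σ_{u ∈ U} wt(u) · Piv(u) ≤ C η^a` uniformly in `s`, small `η` and finite `U` — follows from

* (H4) `FourArmAboveOneAlong k γ`: four alternating arms `≤ C₄ (r/R)^{1+ε}` (the bulk input `x₄ > 1`);
* (HB) **boundary relevance above one** for `F` along `γ`: for every lattice scale `D ≥ 1`, summed over
  the blocks within plane distance `2Dη` of the quad boundaries, `M_k(γ s)(Rel u D) ≤ C₀ D² min(1, (Dη)^b)`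
  with `b > 0` (the boundary analogue of `x₄ > 1`: a boundary box of plane size `ℓ` is relevant with
  probability `O(ℓ^{1+b})` per unit length; the `min 1` branch is block counting at scales `Dη ≥ 1`);
* (HT) **far-field factorisation**: a block lying `4ηR` below the quad boundaries is relevant only if
  four alternating arms cross the annulus `k•u + A_{r₁,R}` AND the `2R`-box is relevant, the two being
  independent under `M_k`: `M(Rel u k) ≤ C₁ · M(fourArmTwoClustersAt (k•u) r₁ R) · M(Rel u (2R))`.

Proof: `Piv u ≤ (2 + 2k²) M(Rel u k)` (`Piv_le_real_Rel`); contact blocks (`bdist < 8R₀η`, weight `≤ 1`)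
are charged to (HB) at scale `8R₀`; the blocks at depth `[8R_jη, 16R_jη)`, `R_j = 2^j R₀`, have weight
`≤ r/(8R_j)`, four arms `≤ C₄ (r₁/R_j)^{1+ε}` by (HT)+(H4) and relevance mass `≤ C₀ (8R_j)² (8R_jη)^{b'}`
by (HB), `b' = min(b, ε/2)`; the layer total `K R_j^{b'−ε} η^{b'} ≤ K 2^{−jε/2} η^{b'}` sums
geometrically, so `a = b'`.  No quad regularity and no arm exponent beyond the three inputs is used.
-/

noncomputable section

namespace Summit.CriticalPhenomena.CardyFormulaZ2.Theorems.CardySelfRefinement.FarField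

open scoped Topology
open Filter Set MeasureTheory
open Literature.Probability.LatticeModels Literature.Probability.Percolation
open Literature.Probability.Percolation.QuadCrossing
open Summit.CriticalPhenomena.CardyFormulaZ2.Theses.CardySelfRefinement

/-! ## The summation theorem -/

/-- **WEIGHTED PIVOTAL MASS FROM (H4) + (HB) + (HT)** (registered helper of `stub_pivotalMass`; see the
module docstring).  The three hypotheses are: four arms above one along `γ`; boundary relevance above
one for `F` along `γ` (with the block-counting branch `min 1`); far-field factorisation of block
relevance through the four-arm event and the relevance of the `2R`-box. -/
theorem weightedPivotalMass_of_factorisation {k : ℕ} (hk : 0 < k) {γ : unitInterval → ℝ × ℝ}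
    (h4 : FourArmAboveOneAlong k γ) {m : ℕ} {F : Fin m → Quad (univ : Set ℂ)}
    (hB : ∃ b C₀ η₀ : ℝ, 0 < b ∧ 0 < η₀ ∧ ∀ (s : unitInterval), ∀ η ∈ Set.Ioo (0 : ℝ) η₀, ∀ (D : ℕ), 1 ≤ D →
        ∀ U : Finset (Site 2),
          ∑ u ∈ U.filter (fun u => bdist k m F η u < 2 * D * η),
            (M k (γ s).1 (γ s).2).real (Rel k m F η u D) ≤ C₀ * (D : ℝ) ^ 2 * min 1 (((D : ℝ) * η) ^ b))
    (hT : ∃ (C₁ : ℝ) (r₁ R₁ : ℕ), 1 ≤ r₁ ∧ ∀ (s : unitInterval) (η : ℝ), 0 < η → ∀ (u : Site 2) (R : ℕ),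
        R₁ ≤ R → 4 * η * R < bdist k m F η u →
          (M k (γ s).1 (γ s).2).real (Rel k m F η u k) ≤
            C₁ * (M k (γ s).1 (γ s).2).real (fourArmTwoClustersAt (ctr k u) r₁ R) *
              (M k (γ s).1 (γ s).2).real (Rel k m F η u (2 * R)))
    (r : ℝ) (hr : 0 < r) :
    ∃ a C η₁ : ℝ, 0 < a ∧ 0 ≤ C ∧ 0 < η₁ ∧ ∀ (s : unitInterval), ∀ η ∈ Set.Ioo (0 : ℝ) η₁,
      ∀ U : Finset (Site 2), ∑ u ∈ U, wt k m F η r u * Piv k m F η (γ s) u ≤ C * η ^ a := by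
  obtain ⟨ε, C₄, hε, h4⟩ := h4
  obtain ⟨b, C₀, η₀, hb, hη₀, hB⟩ := hB
  obtain ⟨C₁, r₁, R₁, hr₁, hT⟩ := hT
  -- nonnegative majorants of the three constants (opaque names with defining equations)
  obtain ⟨C₄', hC₄'⟩ : ∃ C : ℝ, C = max C₄ 0 := ⟨_, rfl⟩
  obtain ⟨C₀', hC₀'⟩ : ∃ C : ℝ, C = max C₀ 0 := ⟨_, rfl⟩
  obtain ⟨C₁', hC₁'⟩ : ∃ C : ℝ, C = max C₁ 0 := ⟨_, rfl⟩
  have hC₄'0 : 0 ≤ C₄' := hC₄' ▸ le_max_right _ _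
  have hC₀'0 : 0 ≤ C₀' := hC₀' ▸ le_max_right _ _
  have hC₁'0 : 0 ≤ C₁' := hC₁' ▸ le_max_right _ _
  have hC₄le : C₄ ≤ C₄' := hC₄' ▸ le_max_left _ _
  have hC₀le : C₀ ≤ C₀' := hC₀' ▸ le_max_left _ _
  have hC₁le : C₁ ≤ C₁' := hC₁' ▸ le_max_left _ _
  -- the base radius `R₀ ≥ R₁, r₁, k`; the contact depth is `8 R₀`
  obtain ⟨R₀, hR₀⟩ : ∃ R : ℕ, R = max (max R₁ r₁) k := ⟨_, rfl⟩
  have hR₁R₀ : R₁ ≤ R₀ := hR₀ ▸ (le_max_left _ _).trans (le_max_left _ _)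
  have hr₁R₀ : r₁ ≤ R₀ := hR₀ ▸ (le_max_right _ _).trans (le_max_left _ _)
  have hkR₀ : k ≤ R₀ := hR₀ ▸ le_max_right _ _
  have hR₀1 : 1 ≤ R₀ := hr₁.trans hr₁R₀
  have hR₀pos : 0 < R₀ := hR₀1
  have hD₀1 : 1 ≤ 8 * R₀ := by omega
  have hkD₀ : k ≤ 8 * R₀ := by omega
  have hD₀c : ((8 * R₀ : ℕ) : ℝ) = 8 * R₀ := by push_cast; ring
  have hD₀pos : (0 : ℝ) < ((8 * R₀ : ℕ) : ℝ) := by rw [hD₀c]; positivity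
  -- exponents and the geometric ratio
  obtain ⟨b', hb'def⟩ : ∃ x : ℝ, x = min b (ε / 2) := ⟨_, rfl⟩
  have hb'0 : 0 < b' := hb'def ▸ lt_min hb (by linarith)
  have hb'b : b' ≤ b := hb'def ▸ min_le_left _ _
  have hb'ε : b' - ε ≤ -(ε / 2) := by have := min_le_right b (ε / 2); rw [← hb'def] at this; linarith
  obtain ⟨q, hqdef⟩ : ∃ x : ℝ, x = (2 : ℝ) ^ (-(ε / 2)) := ⟨_, rfl⟩
  have hq0 : 0 ≤ q := hqdef ▸ Real.rpow_nonneg (by norm_num) _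
  have hq1 : q < 1 := hqdef ▸ Real.rpow_lt_one_of_one_lt_of_neg (by norm_num) (by linarith)
  have h1q : 0 < 1 - q := by linarith
  -- constants
  obtain ⟨A, hAdef⟩ : ∃ x : ℝ, x = (2 + 2 * (k : ℝ) ^ 2) * C₁' * C₄' := ⟨_, rfl⟩
  have hA0 : 0 ≤ A := by rw [hAdef]; positivity
  obtain ⟨K₀, hK₀def⟩ : ∃ x : ℝ, x = (8 : ℝ) ^ (1 + b') * r * A * C₀' * (r₁ : ℝ) ^ (1 + ε) :=
    ⟨_, rfl⟩
  have hK₀0 : 0 ≤ K₀ := by rw [hK₀def]; positivity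
  obtain ⟨Kc, hKcdef⟩ : ∃ x : ℝ,
      x = (2 + 2 * (k : ℝ) ^ 2) * C₀' * ((8 * R₀ : ℕ) : ℝ) ^ 2 * ((8 * R₀ : ℕ) : ℝ) ^ b' := ⟨_, rfl⟩
  have hKc0 : 0 ≤ Kc := by rw [hKcdef]; positivity
  refine ⟨b', Kc + K₀ * (1 - q)⁻¹, η₀, hb'0, by positivity, hη₀, ?_⟩
  intro s η hη U
  have hη0 : 0 < η := hη.1
  haveI := isProbabilityMeasure_M k (γ s).1 (γ s).2
  -- shorthand for the summand
  obtain ⟨f, hfdef⟩ : ∃ g : Site 2 → ℝ, g = fun u => wt k m F η r u * Piv k m F η (γ s) u := ⟨_, rfl⟩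
  have hPiv0 : ∀ u, 0 ≤ Piv k m F η (γ s) u := fun u => by unfold Piv; positivity
  have hf0 : ∀ u, 0 ≤ f u := fun u => by rw [hfdef]; exact mul_nonneg (wt_nonneg' k m F hη0 hr u) (hPiv0 u)
  have hbd0 : ∀ u, 0 ≤ bdist k m F η u := fun u => by unfold bdist; exact Metric.infDist_nonneg
  -- (HB) at scale `D` over blocks within `2Dη`, with the majorant constant and the exponent `b'`
  have hBD : ∀ (D : ℕ), 1 ≤ D → ∀ (V : Finset (Site 2)),
      (∀ u ∈ V, bdist k m F η u < 2 * D * η) →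
      ∑ u ∈ V, (M k (γ s).1 (γ s).2).real (Rel k m F η u D) ≤ C₀' * (D : ℝ) ^ 2 * ((D : ℝ) * η) ^ b' := by
    intro D hD V hV
    have hD0 : (0 : ℝ) < D := by exact_mod_cast hD
    have hfil : V.filter (fun u => bdist k m F η u < 2 * D * η) = V := Finset.filter_true_of_mem hV
    have h := hB s η hη D hD V
    rw [hfil] at h
    have hmin0 : 0 ≤ min 1 (((D : ℝ) * η) ^ b) :=
      le_min zero_le_one (Real.rpow_nonneg (by positivity) _)
    have hmin : min 1 (((D : ℝ) * η) ^ b) ≤ ((D : ℝ) * η) ^ b' :=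
      min_one_rpow_le_rpow (by positivity) hb'0.le hb'b
    calc ∑ u ∈ V, (M k (γ s).1 (γ s).2).real (Rel k m F η u D)
        ≤ C₀ * (D : ℝ) ^ 2 * min 1 (((D : ℝ) * η) ^ b) := h
      _ ≤ C₀' * (D : ℝ) ^ 2 * min 1 (((D : ℝ) * η) ^ b) :=
          mul_le_mul_of_nonneg_right (mul_le_mul_of_nonneg_right hC₀le (by positivity)) hmin0
      _ ≤ C₀' * (D : ℝ) ^ 2 * ((D : ℝ) * η) ^ b' := mul_le_mul_of_nonneg_left hmin (by positivity)
  -- (1) the contact layer `bdist < 8R₀ η`: weight `≤ 1`, relevance at scale `8R₀`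
  have hcontact :
      ∑ u ∈ U.filter (fun u => bdist k m F η u < ((8 * R₀ : ℕ) : ℝ) * η), f u ≤ Kc * η ^ b' := by
    have h1 : ∀ u ∈ U.filter (fun u => bdist k m F η u < ((8 * R₀ : ℕ) : ℝ) * η),
        f u ≤ (2 + 2 * (k : ℝ) ^ 2) * (M k (γ s).1 (γ s).2).real (Rel k m F η u (8 * R₀)) := by
      intro u _
      calc f u = wt k m F η r u * Piv k m F η (γ s) u := by rw [hfdef]
        _ ≤ 1 * Piv k m F η (γ s) u :=
            mul_le_mul_of_nonneg_right (wt_le_one k m F hη0 hr u) (hPiv0 u)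
        _ ≤ (2 + 2 * (k : ℝ) ^ 2) * (M k (γ s).1 (γ s).2).real (Rel k m F η u k) := by
            rw [one_mul]; exact Piv_le_real_Rel k m hk F η (γ s) u
        _ ≤ (2 + 2 * (k : ℝ) ^ 2) * (M k (γ s).1 (γ s).2).real (Rel k m F η u (8 * R₀)) :=
            mul_le_mul_of_nonneg_left
              (measureReal_mono (Rel_mono k m F η u hkD₀) (measure_ne_top _ _)) (by positivity)
    have h2 : ∀ u ∈ U.filter (fun u => bdist k m F η u < ((8 * R₀ : ℕ) : ℝ) * η),
        bdist k m F η u < 2 * ((8 * R₀ : ℕ) : ℝ) * η := by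
      intro u hu
      have := (Finset.mem_filter.1 hu).2
      have : (0 : ℝ) ≤ ((8 * R₀ : ℕ) : ℝ) * η := by positivity
      linarith
    calc ∑ u ∈ U.filter (fun u => bdist k m F η u < ((8 * R₀ : ℕ) : ℝ) * η), f u
        ≤ ∑ u ∈ U.filter (fun u => bdist k m F η u < ((8 * R₀ : ℕ) : ℝ) * η),
            (2 + 2 * (k : ℝ) ^ 2) * (M k (γ s).1 (γ s).2).real (Rel k m F η u (8 * R₀)) :=
          Finset.sum_le_sum h1
      _ = (2 + 2 * (k : ℝ) ^ 2) *
            ∑ u ∈ U.filter (fun u => bdist k m F η u < ((8 * R₀ : ℕ) : ℝ) * η),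
              (M k (γ s).1 (γ s).2).real (Rel k m F η u (8 * R₀)) := by
          rw [Finset.mul_sum]
      _ ≤ (2 + 2 * (k : ℝ) ^ 2) * (C₀' * ((8 * R₀ : ℕ) : ℝ) ^ 2 * (((8 * R₀ : ℕ) : ℝ) * η) ^ b') :=
          mul_le_mul_of_nonneg_left (hBD (8 * R₀) hD₀1 _ h2) (by positivity)
      _ = Kc * η ^ b' := by
          rw [Real.mul_rpow hD₀pos.le hη0.le, hKcdef]
          ring
  -- (2) the dyadic layers `8·2^jR₀ η ≤ bdist < 16·2^jR₀ η`
  have hlayer : ∀ j : ℕ,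
      ∑ u ∈ U.filter (fun u => 8 * ((2 ^ j * R₀ : ℕ) : ℝ) * η ≤ bdist k m F η u ∧
          bdist k m F η u < 16 * ((2 ^ j * R₀ : ℕ) : ℝ) * η), f u ≤ K₀ * q ^ j * η ^ b' := by
    intro j
    have hRj : R₀ ≤ 2 ^ j * R₀ := Nat.le_mul_of_pos_left _ (pow_pos two_pos j)
    have hX1 : (1 : ℝ) ≤ ((2 ^ j * R₀ : ℕ) : ℝ) := by exact_mod_cast hR₀1.trans hRj
    have hX0 : (0 : ℝ) < ((2 ^ j * R₀ : ℕ) : ℝ) := by linarith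
    have hRjR₁ : R₁ ≤ 2 ^ j * R₀ := hR₁R₀.trans hRj
    have hRjr₁ : r₁ ≤ 2 ^ j * R₀ := hr₁R₀.trans hRj
    have h28 : 2 * (2 ^ j * R₀) ≤ 8 * (2 ^ j * R₀) := Nat.mul_le_mul_right _ (by norm_num)
    -- per block: weight × (2+2k²) × C₁' × four arms × relevance of the `8·2^jR₀`-box
    have hblock : ∀ u ∈ U.filter (fun u => 8 * ((2 ^ j * R₀ : ℕ) : ℝ) * η ≤ bdist k m F η u ∧
          bdist k m F η u < 16 * ((2 ^ j * R₀ : ℕ) : ℝ) * η),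
        f u ≤ r / (8 * ((2 ^ j * R₀ : ℕ) : ℝ)) * A * ((r₁ : ℝ) / ((2 ^ j * R₀ : ℕ) : ℝ)) ^ (1 + ε) *
          (M k (γ s).1 (γ s).2).real (Rel k m F η u (8 * (2 ^ j * R₀))) := by
      intro u hu
      obtain ⟨-, hlo, -⟩ := Finset.mem_filter.1 hu
      have hwt : wt k m F η r u ≤ r / (8 * ((2 ^ j * R₀ : ℕ) : ℝ)) := by
        have h := wt_le_div k m F hη0 hr (d := 8 * ((2 ^ j * R₀ : ℕ) : ℝ) * η) (by positivity) hlo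
        rwa [mul_div_mul_right _ _ hη0.ne'] at h
      have hfar : 4 * η * ((2 ^ j * R₀ : ℕ) : ℝ) < bdist k m F η u := by
        have hXη : (0 : ℝ) < ((2 ^ j * R₀ : ℕ) : ℝ) * η := by positivity
        have : 8 * ((2 ^ j * R₀ : ℕ) : ℝ) * η - 4 * η * ((2 ^ j * R₀ : ℕ) : ℝ) =
            4 * (((2 ^ j * R₀ : ℕ) : ℝ) * η) := by ring
        linarith
      have hT' := hT s η hη0 u (2 ^ j * R₀) hRjR₁ hfar
      have h4' := h4 s (ctr k u) r₁ (2 ^ j * R₀) hr₁ hRjr₁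
      have hpow0 : 0 ≤ ((r₁ : ℝ) / ((2 ^ j * R₀ : ℕ) : ℝ)) ^ (1 + ε) := Real.rpow_nonneg (by positivity) _
      have hFA : (M k (γ s).1 (γ s).2).real (fourArmTwoClustersAt (ctr k u) r₁ (2 ^ j * R₀)) ≤
          C₄' * ((r₁ : ℝ) / ((2 ^ j * R₀ : ℕ) : ℝ)) ^ (1 + ε) :=
        h4'.trans (mul_le_mul_of_nonneg_right hC₄le hpow0)
      have hRel2 : (M k (γ s).1 (γ s).2).real (Rel k m F η u (2 * (2 ^ j * R₀))) ≤
          (M k (γ s).1 (γ s).2).real (Rel k m F η u (8 * (2 ^ j * R₀))) :=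
        measureReal_mono (Rel_mono k m F η u h28) (measure_ne_top _ _)
      have hRel : (M k (γ s).1 (γ s).2).real (Rel k m F η u k) ≤
          C₁' * (C₄' * ((r₁ : ℝ) / ((2 ^ j * R₀ : ℕ) : ℝ)) ^ (1 + ε)) *
            (M k (γ s).1 (γ s).2).real (Rel k m F η u (8 * (2 ^ j * R₀))) :=
        calc (M k (γ s).1 (γ s).2).real (Rel k m F η u k)
            ≤ C₁ * (M k (γ s).1 (γ s).2).real (fourArmTwoClustersAt (ctr k u) r₁ (2 ^ j * R₀)) *
                (M k (γ s).1 (γ s).2).real (Rel k m F η u (2 * (2 ^ j * R₀))) := hT'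
          _ ≤ C₁' * (M k (γ s).1 (γ s).2).real (fourArmTwoClustersAt (ctr k u) r₁ (2 ^ j * R₀)) *
                (M k (γ s).1 (γ s).2).real (Rel k m F η u (2 * (2 ^ j * R₀))) :=
              mul_le_mul_of_nonneg_right (mul_le_mul_of_nonneg_right hC₁le measureReal_nonneg)
                measureReal_nonneg
          _ ≤ C₁' * (C₄' * ((r₁ : ℝ) / ((2 ^ j * R₀ : ℕ) : ℝ)) ^ (1 + ε)) *
                (M k (γ s).1 (γ s).2).real (Rel k m F η u (8 * (2 ^ j * R₀))) :=
              mul_le_mul (mul_le_mul_of_nonneg_left hFA hC₁'0) hRel2 measureReal_nonneg (by positivity)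
      calc f u = wt k m F η r u * Piv k m F η (γ s) u := by rw [hfdef]
        _ ≤ r / (8 * ((2 ^ j * R₀ : ℕ) : ℝ)) *
              ((2 + 2 * (k : ℝ) ^ 2) * (M k (γ s).1 (γ s).2).real (Rel k m F η u k)) :=
            mul_le_mul hwt (Piv_le_real_Rel k m hk F η (γ s) u) (hPiv0 u) (by positivity)
        _ ≤ r / (8 * ((2 ^ j * R₀ : ℕ) : ℝ)) * ((2 + 2 * (k : ℝ) ^ 2) *
              (C₁' * (C₄' * ((r₁ : ℝ) / ((2 ^ j * R₀ : ℕ) : ℝ)) ^ (1 + ε)) *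
                (M k (γ s).1 (γ s).2).real (Rel k m F η u (8 * (2 ^ j * R₀))))) :=
            mul_le_mul_of_nonneg_left (mul_le_mul_of_nonneg_left hRel (by positivity)) (by positivity)
        _ = r / (8 * ((2 ^ j * R₀ : ℕ) : ℝ)) * A * ((r₁ : ℝ) / ((2 ^ j * R₀ : ℕ) : ℝ)) ^ (1 + ε) *
              (M k (γ s).1 (γ s).2).real (Rel k m F η u (8 * (2 ^ j * R₀))) := by
            rw [hAdef]; ring
    -- sum over the layer: (HB) at scale `8·2^jR₀`, then the layer algebra and the geometric factor
    have hnear : ∀ u ∈ U.filter (fun u => 8 * ((2 ^ j * R₀ : ℕ) : ℝ) * η ≤ bdist k m F η u ∧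
          bdist k m F η u < 16 * ((2 ^ j * R₀ : ℕ) : ℝ) * η),
        bdist k m F η u < 2 * ((8 * (2 ^ j * R₀) : ℕ) : ℝ) * η := by
      intro u hu
      obtain ⟨-, -, hhi⟩ := Finset.mem_filter.1 hu
      refine hhi.trans_eq ?_
      push_cast
      ring
    have hD1 : 1 ≤ 8 * (2 ^ j * R₀) := by
      have := hR₀1.trans hRj
      omega
    have hsum := hBD (8 * (2 ^ j * R₀)) hD1 _ hnear
    have hcast : ((8 * (2 ^ j * R₀) : ℕ) : ℝ) = 8 * ((2 ^ j * R₀ : ℕ) : ℝ) := by push_cast; ring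
    rw [hcast] at hsum
    have hgeom : ((2 ^ j * R₀ : ℕ) : ℝ) ^ (-(ε / 2)) ≤ q ^ j := by
      rw [hqdef]
      exact rpow_neg_le_geom hε hR₀1 j
    have hpref :
        0 ≤ r / (8 * ((2 ^ j * R₀ : ℕ) : ℝ)) * A * ((r₁ : ℝ) / ((2 ^ j * R₀ : ℕ) : ℝ)) ^ (1 + ε) := by
      positivity
    calc ∑ u ∈ U.filter (fun u => 8 * ((2 ^ j * R₀ : ℕ) : ℝ) * η ≤ bdist k m F η u ∧
            bdist k m F η u < 16 * ((2 ^ j * R₀ : ℕ) : ℝ) * η), f u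
        ≤ ∑ u ∈ U.filter (fun u => 8 * ((2 ^ j * R₀ : ℕ) : ℝ) * η ≤ bdist k m F η u ∧
            bdist k m F η u < 16 * ((2 ^ j * R₀ : ℕ) : ℝ) * η),
            r / (8 * ((2 ^ j * R₀ : ℕ) : ℝ)) * A * ((r₁ : ℝ) / ((2 ^ j * R₀ : ℕ) : ℝ)) ^ (1 + ε) *
              (M k (γ s).1 (γ s).2).real (Rel k m F η u (8 * (2 ^ j * R₀))) :=
          Finset.sum_le_sum hblock
      _ = r / (8 * ((2 ^ j * R₀ : ℕ) : ℝ)) * A * ((r₁ : ℝ) / ((2 ^ j * R₀ : ℕ) : ℝ)) ^ (1 + ε) *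
            ∑ u ∈ U.filter (fun u => 8 * ((2 ^ j * R₀ : ℕ) : ℝ) * η ≤ bdist k m F η u ∧
              bdist k m F η u < 16 * ((2 ^ j * R₀ : ℕ) : ℝ) * η),
              (M k (γ s).1 (γ s).2).real (Rel k m F η u (8 * (2 ^ j * R₀))) := by
          rw [Finset.mul_sum]
      _ ≤ r / (8 * ((2 ^ j * R₀ : ℕ) : ℝ)) * A * ((r₁ : ℝ) / ((2 ^ j * R₀ : ℕ) : ℝ)) ^ (1 + ε) *
            (C₀' * (8 * ((2 ^ j * R₀ : ℕ) : ℝ)) ^ 2 * (8 * ((2 ^ j * R₀ : ℕ) : ℝ) * η) ^ b') :=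
          mul_le_mul_of_nonneg_left hsum hpref
      _ ≤ (8 : ℝ) ^ (1 + b') * r * A * C₀' * (r₁ : ℝ) ^ (1 + ε) * ((2 ^ j * R₀ : ℕ) : ℝ) ^ (-(ε / 2)) *
            η ^ b' :=
          layer_algebra hX1 hη0 hr.le (by positivity) hA0 hC₀'0 hb'ε
      _ = K₀ * ((2 ^ j * R₀ : ℕ) : ℝ) ^ (-(ε / 2)) * η ^ b' := by rw [hK₀def]
      _ ≤ K₀ * q ^ j * η ^ b' :=
          mul_le_mul_of_nonneg_right (mul_le_mul_of_nonneg_left hgeom hK₀0) (by positivity)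
  -- (3) every block is a contact block or lies in a layer `j < J`
  obtain ⟨T, hTdef⟩ : ∃ x : ℝ, x = (∑ u ∈ U, bdist k m F η u) / (((8 * R₀ : ℕ) : ℝ) * η) + 1 :=
    ⟨_, rfl⟩
  obtain ⟨J, hJ⟩ := pow_unbounded_of_one_lt T (one_lt_two : (1 : ℝ) < 2)
  have hD₀η : 0 < ((8 * R₀ : ℕ) : ℝ) * η := by positivity
  have hcover : ∀ u ∈ U, f u ≤ (if bdist k m F η u < ((8 * R₀ : ℕ) : ℝ) * η then f u else 0) +
      ∑ j ∈ Finset.range J,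
        (if 8 * ((2 ^ j * R₀ : ℕ) : ℝ) * η ≤ bdist k m F η u ∧
            bdist k m F η u < 16 * ((2 ^ j * R₀ : ℕ) : ℝ) * η then f u else 0) := by
    intro u hu
    have hterm0 : ∀ j, 0 ≤ (if 8 * ((2 ^ j * R₀ : ℕ) : ℝ) * η ≤ bdist k m F η u ∧
        bdist k m F η u < 16 * ((2 ^ j * R₀ : ℕ) : ℝ) * η then f u else 0) := fun j => by
      split_ifs
      · exact hf0 u
      · exact le_rfl
    have hsum0 : 0 ≤ ∑ j ∈ Finset.range J,
        (if 8 * ((2 ^ j * R₀ : ℕ) : ℝ) * η ≤ bdist k m F η u ∧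
            bdist k m F η u < 16 * ((2 ^ j * R₀ : ℕ) : ℝ) * η then f u else 0) :=
      Finset.sum_nonneg fun j _ => hterm0 j
    by_cases hc : bdist k m F η u < ((8 * R₀ : ℕ) : ℝ) * η
    · rw [if_pos hc]
      linarith
    · rw [if_neg hc, zero_add]
      obtain ⟨x, hxdef⟩ : ∃ y : ℝ, y = bdist k m F η u / (((8 * R₀ : ℕ) : ℝ) * η) := ⟨_, rfl⟩
      have hbd : bdist k m F η u = x * (((8 * R₀ : ℕ) : ℝ) * η) := by
        rw [hxdef, div_mul_cancel₀ _ hD₀η.ne']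
      have hx1 : 1 ≤ x := by
        rw [hxdef, le_div_iff₀ hD₀η]
        linarith
      obtain ⟨n, hn1, hn2⟩ := exists_nat_pow_near hx1 one_lt_two
      have hxT : x < T := by
        have h1 : bdist k m F η u ≤ ∑ v ∈ U, bdist k m F η v :=
          Finset.single_le_sum (fun v _ => hbd0 v) hu
        have h2 : x ≤ (∑ v ∈ U, bdist k m F η v) / (((8 * R₀ : ℕ) : ℝ) * η) := by
          rw [hxdef]
          exact div_le_div_of_nonneg_right h1 hD₀η.le
        rw [hTdef]
        linarith
      have hnJ : n < J := by
        have : (2 : ℝ) ^ n < 2 ^ J := lt_of_le_of_lt hn1 (hxT.trans hJ)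
        exact (pow_lt_pow_iff_right₀ one_lt_two).1 this
      have hlayer_n : 8 * ((2 ^ n * R₀ : ℕ) : ℝ) * η ≤ bdist k m F η u ∧
          bdist k m F η u < 16 * ((2 ^ n * R₀ : ℕ) : ℝ) * η := by
        have hpos : (0 : ℝ) < 8 * R₀ * η := by positivity
        have hc2 : ((2 ^ n * R₀ : ℕ) : ℝ) = 2 ^ n * R₀ := by push_cast; ring
        rw [hbd, hD₀c, hc2]
        constructor
        · calc (8 : ℝ) * (2 ^ n * R₀) * η = 2 ^ n * (8 * R₀ * η) := by ring
            _ ≤ x * (8 * R₀ * η) := mul_le_mul_of_nonneg_right hn1 hpos.le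
        · calc x * (8 * (R₀ : ℝ) * η) < 2 ^ (n + 1) * (8 * R₀ * η) := mul_lt_mul_of_pos_right hn2 hpos
            _ = 16 * (2 ^ n * R₀) * η := by rw [pow_succ]; ring
      calc f u = (if 8 * ((2 ^ n * R₀ : ℕ) : ℝ) * η ≤ bdist k m F η u ∧
            bdist k m F η u < 16 * ((2 ^ n * R₀ : ℕ) : ℝ) * η then f u else 0) := by rw [if_pos hlayer_n]
        _ ≤ ∑ j ∈ Finset.range J,
            (if 8 * ((2 ^ j * R₀ : ℕ) : ℝ) * η ≤ bdist k m F η u ∧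
              bdist k m F η u < 16 * ((2 ^ j * R₀ : ℕ) : ℝ) * η then f u else 0) :=
          Finset.single_le_sum (f := fun j => (if 8 * ((2 ^ j * R₀ : ℕ) : ℝ) * η ≤ bdist k m F η u ∧
              bdist k m F η u < 16 * ((2 ^ j * R₀ : ℕ) : ℝ) * η then f u else 0))
            (fun j _ => hterm0 j) (Finset.mem_range.2 hnJ)
  -- (4) assemble
  have hgeomsum : ∑ j ∈ Finset.range J, q ^ j ≤ (1 - q)⁻¹ :=
    sum_le_hasSum (Finset.range J) (fun j _ => pow_nonneg hq0 j) (hasSum_geometric_of_lt_one hq0 hq1)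
  have hfin : ∑ u ∈ U, f u ≤ (Kc + K₀ * (1 - q)⁻¹) * η ^ b' :=
    calc ∑ u ∈ U, f u
        ≤ ∑ u ∈ U, ((if bdist k m F η u < ((8 * R₀ : ℕ) : ℝ) * η then f u else 0) +
            ∑ j ∈ Finset.range J,
              (if 8 * ((2 ^ j * R₀ : ℕ) : ℝ) * η ≤ bdist k m F η u ∧
                bdist k m F η u < 16 * ((2 ^ j * R₀ : ℕ) : ℝ) * η then f u else 0)) :=
          Finset.sum_le_sum hcover
      _ = ∑ u ∈ U.filter (fun u => bdist k m F η u < ((8 * R₀ : ℕ) : ℝ) * η), f u +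
            ∑ j ∈ Finset.range J,
              ∑ u ∈ U.filter (fun u => 8 * ((2 ^ j * R₀ : ℕ) : ℝ) * η ≤ bdist k m F η u ∧
                bdist k m F η u < 16 * ((2 ^ j * R₀ : ℕ) : ℝ) * η), f u := by
          rw [Finset.sum_add_distrib, Finset.sum_comm, Finset.sum_filter]
          congr 1
          exact Finset.sum_congr rfl fun j _ => (Finset.sum_filter _ _).symm
      _ ≤ Kc * η ^ b' + ∑ j ∈ Finset.range J, K₀ * q ^ j * η ^ b' :=
          add_le_add hcontact (Finset.sum_le_sum fun j _ => hlayer j)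
      _ = Kc * η ^ b' + K₀ * η ^ b' * ∑ j ∈ Finset.range J, q ^ j := by
          rw [Finset.mul_sum]
          congr 1
          exact Finset.sum_congr rfl fun j _ => by ring
      _ ≤ Kc * η ^ b' + K₀ * η ^ b' * (1 - q)⁻¹ := by
          gcongr
      _ = (Kc + K₀ * (1 - q)⁻¹) * η ^ b' := by ring
  simpa only [hfdef] using hfin

end Summit.CriticalPhenomena.CardyFormulaZ2.Theorems.CardySelfRefinement.FarField

end
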